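import Mathlib
import HarnessLib
import Literature.Combinatorics.Additive.Pollard
import Literature.Combinatorics.Additive.Vosper
import Literature.Combinatorics.Additive.GrynkiewiczPollardRep

/-!
# Equality in Pollard's theorem (Nazarewicz–O'Brien–O'Neill–Staples 2007), II: an arithmetic
# progression forces its partner to be one (printed Lemma 1)

Topic: `Literature/Combinatorics/Additive`.  E. Nazarewicz, M. O'Brien, M. O'Neill, C. Staples,
*Equality in Pollard's theorem on set addition of congruence classes*, Acta Arith. 127 (2007) 1–15
(held `paper:doi-10-4064-aa127-1-1`), **Lemma 1** (p. 3):

«Let `(A, B)` be a `t`-critical pair of subsets of `ℤ_p`, and suppose that `1 < t < min{|A|, |B|}` and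
`|A| + |B| < p + t`.  If `A` is an arithmetic progression then `B` is an arithmetic progression with the
same common difference.»

(`t`-critical: `S_t(A,B) = Σ_x min(t, r_{A,B}(x)) = t(|A| + |B| − t)`, equality in Pollard's theorem; see
`PollardEqualityModP.lean` for notation.)  Main statement: `PollardEquality.isAP_of_critical_of_isAP`.

Proof as printed (pp. 3–4), with `A = {0, 1, …, k−1}` after a dilation and a translation: writing
`B = {r_0 < ⋯ < r_{ℓ−1}}` and `g_j = r_{j+t} − r_j` (indices cyclic), one has
`S_t(A,B) = Σ_j min(k, g_j)` (eq. before (3)), `Σ_j g_j = tp`, `t ≤ g_j ≤ p + t − ℓ`; criticality then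
forces exactly `t` indices with `g_j > k` and `g_j = t` (i.e. `r_j + 1, …, r_j + t ∈ B`) for the other
`ℓ − t` (displays (3)–(4)).  RENDERING without sorting: for `b ∈ B` and `m ∈ ℕ` let
`c_b(m) = #{i ∈ [1, m] : b + i ∈ B}`; then `min(t, r_{A,B}(x))` counts the `b ∈ B` in the window
`x − b ∈ [0, k)` having `c_b(val(x − b)) ≤ t − 1` (the last `t` elements of `B` in the window —
`card_filter_rank_succ_le`, a generic "the `t` smallest keys" count), so by Fubini
`S_t(A,B) = Σ_{b ∈ B} #{m < k : c_b(m) ≤ t − 1} = Σ_b min(k, g_b)` with `g_b = #{m < p : c_b(m) ≤ t − 1}`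
(`= r_{j+t} − r_j`), and `Σ_b g_b = tp` is the same count for the window `[0, p)`.  DEVIATION (last
paragraph of the printed proof): instead of decomposing `B` into runs we finish with
`F = {b ∈ B : b + 1, …, b + t ∈ B}`, `|F| ≥ ℓ − t`: the elements of `F + {0, …, t−1} ⊆ B` all have their
successor in `B`, so by Cauchy–Davenport at most one element of `B` lacks its successor, and `B` is an
interval (tree `isAP_of_card_union_vadd`).

## References
* E. Nazarewicz, M. O'Brien, M. O'Neill, C. Staples, Acta Arith. 127 (2007) 1–15, Lemma 1
  [cite: NazarewiczEtAl2007, Lemma 1].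
* M. B. Nathanson, *Additive Number Theory: Inverse Problems and the Geometry of Sumsets*, GTM 165
  (1996), §2.3 and §2.5 [cite: Nathanson1996, Thm 2.4].
-/

namespace Literature.Combinatorics.Additive

namespace PollardEquality

open Finset Pollard Grynkiewicz
open scoped Pointwise

/-! ### A generic count: the `t` elements with smallest keys -/

section Rank

variable {α : Type*} [DecidableEq α]

/-- For an injective key `κ` on a finite set `W`, the number of `b ∈ W` with fewer than `t` elements of
smaller key is `min(t, |W|)` (the `t` smallest keys).  [folklore; used for
[cite: NazarewiczEtAl2007, Lemma 1 (proof, the identity before (3))]] -/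
theorem card_filter_rank_succ_le (κ : α → ℕ) (t : ℕ) :
    ∀ (n : ℕ) (W : Finset α), #W = n → Set.InjOn κ W →
      #(W.filter fun b => #(W.filter fun b' => κ b' < κ b) + 1 ≤ t) = min t #W := by
  intro n
  induction n using Nat.strong_induction_on with
  | _ n ih =>
  intro W hWn hinj
  have hrank_le : ∀ b ∈ W, #(W.filter fun b' => κ b' < κ b) + 1 ≤ #W := by
    intro b hb
    have hsub : W.filter (fun b' => κ b' < κ b) ⊆ W.erase b := by
      intro b' hb'
      rw [mem_filter] at hb'
      exact mem_erase.2 ⟨fun h => by rw [h] at hb'; exact lt_irrefl _ hb'.2, hb'.1⟩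
    have := card_le_card hsub
    rw [card_erase_of_mem hb] at this
    have hpos : 0 < #W := card_pos.2 ⟨b, hb⟩
    omega
  by_cases hWt : #W ≤ t
  · rw [min_eq_right hWt, filter_true_of_mem fun b hb => (hrank_le b hb).trans hWt]
  · push Not at hWt
    rw [min_eq_left hWt.le]
    have hWne : W.Nonempty := card_pos.1 (by omega)
    obtain ⟨m, hmW, hmax⟩ := exists_max_image W κ hWne
    have hlt_of_ne : ∀ b ∈ W, b ≠ m → κ b < κ m := by
      intro b hb hne
      exact lt_of_le_of_ne (hmax b hb) fun h => hne (hinj hb hmW h)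
    -- the rank of `m` is `|W| - 1 ≥ t`
    have hrank_m : #(W.filter fun b' => κ b' < κ m) = #W - 1 := by
      have : W.filter (fun b' => κ b' < κ m) = W.erase m := by
        ext b'
        rw [mem_filter, mem_erase]
        constructor
        · rintro ⟨hb', hlt⟩; exact ⟨fun h => by rw [h] at hlt; exact lt_irrefl _ hlt, hb'⟩
        · rintro ⟨hne, hb'⟩; exact ⟨hb', hlt_of_ne b' hb' hne⟩
      rw [this, card_erase_of_mem hmW]
    -- ranks of the other elements are unchanged after erasing `m`
    have hrank_eq : ∀ b ∈ W.erase m,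
        (W.erase m).filter (fun b' => κ b' < κ b) = W.filter (fun b' => κ b' < κ b) := by
      intro b hb
      rw [mem_erase] at hb
      ext b'
      rw [mem_filter, mem_filter, mem_erase]
      constructor
      · rintro ⟨⟨-, hb'⟩, hlt⟩; exact ⟨hb', hlt⟩
      · rintro ⟨hb', hlt⟩
        refine ⟨⟨fun h => ?_, hb'⟩, hlt⟩
        rw [h] at hlt
        exact lt_irrefl _ ((hlt_of_ne b hb.2 hb.1).trans hlt)
    have hset : W.filter (fun b => #(W.filter fun b' => κ b' < κ b) + 1 ≤ t) =
        (W.erase m).filter (fun b => #((W.erase m).filter fun b' => κ b' < κ b) + 1 ≤ t) := by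
      ext b
      rw [mem_filter, mem_filter, mem_erase]
      constructor
      · rintro ⟨hb, hle⟩
        have hne : b ≠ m := by
          rintro rfl; rw [hrank_m] at hle; omega
        refine ⟨⟨hne, hb⟩, ?_⟩
        rwa [hrank_eq b (mem_erase.2 ⟨hne, hb⟩)]
      · rintro ⟨⟨hne, hb⟩, hle⟩
        refine ⟨hb, ?_⟩
        rwa [hrank_eq b (mem_erase.2 ⟨hne, hb⟩)] at hle
    rw [hset, ih (#W - 1) (by omega) (W.erase m) (card_erase_of_mem hmW)
      (hinj.mono (coe_subset.2 (erase_subset m W))), card_erase_of_mem hmW]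
    exact min_eq_left (by omega)

end Rank

section ZModP

variable {p : ℕ} [hp : Fact p.Prime]

/-! ### Coordinates in `ℤ/pℤ`: `val`, intervals `{0, …, k−1}` -/

/-- `x ∈ {0, 1, …, k−1}` (as `apFinset 0 1 k`, `k ≤ p`) iff `val x < k`. [cite: NazarewiczEtAl2007, Lemma 1 (proof, "A = {0, 1, …, k − 1} + pℤ")] -/
theorem mem_apFinset_zero_one {k : ℕ} (hk : k ≤ p) {x : ZMod p} :
    x ∈ apFinset (0 : ZMod p) 1 k ↔ x.val < k := by
  rw [mem_apFinset]
  constructor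
  · rintro ⟨i, hi, rfl⟩
    rw [zero_add, nsmul_eq_mul, mul_one, ZMod.val_natCast, Nat.mod_eq_of_lt (by omega)]
    exact hi
  · intro h
    refine ⟨x.val, h, ?_⟩
    rw [zero_add, nsmul_eq_mul, mul_one, ZMod.natCast_zmod_val]

/-- `val (x − b) = m` iff `x = b + m` (`m < p`). [folklore] -/
private theorem val_sub_eq_iff {x b : ZMod p} {m : ℕ} (hm : m < p) : (x - b).val = m ↔ x = b + m := by
  constructor
  · intro h
    have : ((x - b).val : ZMod p) = (m : ZMod p) := by rw [h]
    rw [ZMod.natCast_zmod_val] at this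
    rw [← this]; abel
  · rintro rfl
    rw [add_sub_cancel_left, ZMod.val_natCast, Nat.mod_eq_of_lt hm]

/-- `val ((m : ZMod p) − (i : ZMod p)) = m − i` for `i ≤ m < p`. [folklore] -/
private theorem val_natCast_sub {m i : ℕ} (him : i ≤ m) (hm : m < p) :
    ((m : ZMod p) - (i : ZMod p)).val = m - i := by
  rw [← Nat.cast_sub him, ZMod.val_natCast, Nat.mod_eq_of_lt (by omega)]

/-! ### The counting function `c_b(m) = #{i ∈ [1, m] : b + i ∈ B}` -/

/-- Monotonicity of `c_b(m) = #{i ∈ [1,m] : b + i ∈ B}` in `m`. [cite: NazarewiczEtAl2007, Lemma 1 (proof)] -/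
theorem count_mono (B : Finset (ZMod p)) (b : ZMod p) {m m' : ℕ} (h : m ≤ m') :
    #((Icc 1 m).filter fun i : ℕ => b + (i : ZMod p) ∈ B) ≤
      #((Icc 1 m').filter fun i : ℕ => b + (i : ZMod p) ∈ B) :=
  card_le_card (filter_subset_filter _ (Icc_subset_Icc_right h))

/-- `c_b(m) ≤ m`. [cite: NazarewiczEtAl2007, Lemma 1 (proof)] -/
theorem count_le (B : Finset (ZMod p)) (b : ZMod p) (m : ℕ) :
    #((Icc 1 m).filter fun i : ℕ => b + (i : ZMod p) ∈ B) ≤ m :=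
  (card_le_card (filter_subset _ _)).trans (by rw [Nat.card_Icc]; omega)

/-- `c_b(m) ≥ m − (p − |B|)` for `m < p`: among the `m` distinct points `b + 1, …, b + m` at most
`p − |B|` lie outside `B`. [cite: NazarewiczEtAl2007, Lemma 1 (proof, "r_{j+t} − r_j ≤ p + t − ℓ")] -/
theorem le_count_add (B : Finset (ZMod p)) (b : ZMod p) {m : ℕ} (hm : m < p) :
    m ≤ #((Icc 1 m).filter fun i : ℕ => b + (i : ZMod p) ∈ B) + (p - #B) := by
  have hinj : Set.InjOn (fun i : ℕ => b + (i : ZMod p)) (Icc 1 m : Finset ℕ) := by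
    intro i hi j hj hij
    simp only [coe_Icc, Set.mem_Icc] at hi hj
    have h1 : (i : ZMod p) = (j : ZMod p) := add_left_cancel hij
    have h2 := congrArg ZMod.val h1
    rwa [ZMod.val_natCast, ZMod.val_natCast, Nat.mod_eq_of_lt (by omega),
      Nat.mod_eq_of_lt (by omega)] at h2
  -- the complement part maps injectively into `Bᶜ`
  have h1 : #((Icc 1 m).filter fun i : ℕ => ¬ b + (i : ZMod p) ∈ B) ≤ p - #B := by
    have := card_le_card_of_injOn (fun i : ℕ => b + (i : ZMod p))
      (s := (Icc 1 m).filter fun i : ℕ => ¬ b + (i : ZMod p) ∈ B) (t := Bᶜ)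
      (fun i hi => by
        rw [mem_coe, mem_filter] at hi
        exact mem_coe.2 (mem_compl.2 hi.2))
      (hinj.mono (coe_subset.2 (filter_subset _ _)))
    rwa [card_compl, ZMod.card] at this
  have h2 := card_filter_add_card_filter_not (s := Icc 1 m) (fun i : ℕ => b + (i : ZMod p) ∈ B)
  rw [Nat.card_Icc] at h2
  omega

/-- If `c_b(t) ≥ t` then `b + 1, …, b + t ∈ B`. [cite: NazarewiczEtAl2007, Lemma 1 (proof, "r_j + i + pℤ ∈ B for each i ∈ {0, …, t}")] -/
theorem forall_add_mem_of_le_count {B : Finset (ZMod p)} {b : ZMod p} {t : ℕ}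
    (h : t ≤ #((Icc 1 t).filter fun i : ℕ => b + (i : ZMod p) ∈ B)) :
    ∀ i : ℕ, 1 ≤ i → i ≤ t → b + (i : ZMod p) ∈ B := by
  have hEq : (Icc 1 t).filter (fun i : ℕ => b + (i : ZMod p) ∈ B) = Icc 1 t :=
    eq_of_subset_of_card_le (filter_subset _ _) (by rw [Nat.card_Icc]; omega)
  intro i hi1 hit
  have : i ∈ (Icc 1 t).filter (fun i : ℕ => b + (i : ZMod p) ∈ B) := by
    rw [hEq]; exact mem_Icc.2 ⟨hi1, hit⟩
  exact (mem_filter.1 this).2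

/-- **The rank interpretation of `c_b`**: for `b ∈ B` (indeed any `b`) and `x` with `val(x − b) = m`,
`c_b(m) = #{b' ∈ B : val(x − b') < val(x − b)}` (the elements of `B` strictly between `b` and `x`,
going forward from `b`). [cite: NazarewiczEtAl2007, Lemma 1 (proof)] -/
theorem count_val_sub_eq (B : Finset (ZMod p)) (b x : ZMod p) :
    #((Icc 1 (x - b).val).filter fun i : ℕ => b + (i : ZMod p) ∈ B) =
      #(B.filter fun b' => (x - b').val < (x - b).val) := by
  set m := (x - b).val with hm
  have hmp : m < p := ZMod.val_lt _
  have hxb : x = b + m := (val_sub_eq_iff hmp).1 rfl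
  refine card_nbij' (fun i : ℕ => b + (i : ZMod p)) (fun b' => m - (x - b').val) ?_ ?_ ?_ ?_
  · intro i hi
    simp only [mem_coe, mem_filter, mem_Icc] at hi ⊢
    refine ⟨hi.2, ?_⟩
    have : x - (b + (i : ZMod p)) = (m : ZMod p) - (i : ZMod p) := by rw [hxb]; abel
    rw [this, val_natCast_sub hi.1.2 hmp]
    omega
  · intro b' hb'
    simp only [mem_coe, mem_filter, mem_Icc] at hb' ⊢
    refine ⟨⟨by omega, by omega⟩, ?_⟩
    have key : (((x - b').val : ℕ) : ZMod p) = x - b' := ZMod.natCast_zmod_val _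
    have : b + ((m - (x - b').val : ℕ) : ZMod p) = b' := by
      rw [Nat.cast_sub hb'.2.le, key, hxb]; abel
    rw [this]; exact hb'.1
  · intro i hi
    simp only [mem_coe, mem_filter, mem_Icc] at hi ⊢
    have : x - (b + (i : ZMod p)) = (m : ZMod p) - (i : ZMod p) := by rw [hxb]; abel
    rw [this, val_natCast_sub hi.1.2 hmp]
    omega
  · intro b' hb'
    simp only [mem_coe, mem_filter] at hb' ⊢
    have key : (((x - b').val : ℕ) : ZMod p) = x - b' := ZMod.natCast_zmod_val _
    rw [Nat.cast_sub hb'.2.le, key, hxb]; abel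

/-! ### `min(t, r_{A,B}(x))` as a count, and Fubini -/

/-- For the interval `A = {0, …, k−1}` (`k ≤ p`): `min(t, r_{A,B}(x))` is the number of `b ∈ B` with
`val(x − b) < k` and `c_b(val(x − b)) + 1 ≤ t` — the display
"`min{t, r_{A,B}(x)} = |{j : r_j ≤ x ≤ r_j + min{k − 1, r_{j+t} − r_j − 1}}|`".
[cite: NazarewiczEtAl2007, Lemma 1 (proof)] -/
theorem min_rep_eq_card_filter {k : ℕ} (hk : k ≤ p) (B : Finset (ZMod p)) (t : ℕ) (x : ZMod p) :
    min t (rep (apFinset (0 : ZMod p) 1 k) B x) =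
      #(B.filter fun b => (x - b).val < k ∧
        #((Icc 1 (x - b).val).filter fun i : ℕ => b + (i : ZMod p) ∈ B) + 1 ≤ t) := by
  obtain ⟨W, hW⟩ : ∃ W : Finset (ZMod p), W = B.filter fun b => (x - b).val < k := ⟨_, rfl⟩
  have hrep : rep (apFinset (0 : ZMod p) 1 k) B x = #W := by
    rw [rep_eq_card_filter_right, hW]
    congr 1
    exact filter_congr fun b _ => mem_apFinset_zero_one hk
  have hinj : Set.InjOn (fun b : ZMod p => (x - b).val) W := by
    intro b _ b' _ h
    have := congrArg (fun n : ℕ => (n : ZMod p)) h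
    simp only [ZMod.natCast_zmod_val] at this
    exact sub_right_injective this
  have hrank := card_filter_rank_succ_le (fun b : ZMod p => (x - b).val) t #W W rfl hinj
  rw [hrep, ← hrank]
  congr 1
  rw [hW, filter_filter]
  refine filter_congr fun b hb => ?_
  constructor
  · rintro ⟨hbk, hle⟩
    refine ⟨hbk, ?_⟩
    rw [count_val_sub_eq]
    convert hle using 3
    rw [filter_filter]
    exact filter_congr fun b' _ => ⟨fun h => ⟨h.trans hbk, h⟩, fun h => h.2⟩
  · rintro ⟨hbk, hle⟩
    refine ⟨hbk, ?_⟩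
    rw [count_val_sub_eq] at hle
    convert hle using 3
    rw [filter_filter]
    exact filter_congr fun b' _ => ⟨fun h => h.2, fun h => ⟨h.trans hbk, h⟩⟩

/-- Fubini: `Σ_x #{b ∈ B : val(x−b) < K ∧ P(b, val(x−b))} = Σ_{b ∈ B} #{m < K : P(b, m)}` (`K ≤ p`),
through `x = b + m`. [cite: NazarewiczEtAl2007, Lemma 1 (proof, the double sum after (2))] -/
theorem sum_card_filter_val_sub {K : ℕ} (hK : K ≤ p) (B : Finset (ZMod p)) (P : ZMod p → ℕ → Prop)
    [∀ b m, Decidable (P b m)] :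
    ∑ x, #(B.filter fun b => (x - b).val < K ∧ P b (x - b).val) =
      ∑ b ∈ B, #((range K).filter fun m => P b m) := by
  simp_rw [card_filter]
  rw [sum_comm]
  refine sum_congr rfl fun b _ => ?_
  -- reindex `x ↦ m = val (x - b)` on the support
  rw [← sum_filter, ← sum_filter]
  simp only [sum_const, smul_eq_mul, mul_one]
  refine card_nbij' (fun x => (x - b).val) (fun m : ℕ => b + (m : ZMod p)) ?_ ?_ ?_ ?_
  · intro x hx
    rw [mem_coe, mem_filter] at hx
    rw [mem_coe, mem_filter, mem_range]
    exact ⟨hx.2.1, hx.2.2⟩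
  · intro m hm
    rw [mem_coe, mem_filter, mem_range] at hm
    rw [mem_coe, mem_filter]
    have hv : (b + (m : ZMod p) - b).val = m := by
      rw [add_sub_cancel_left, ZMod.val_natCast, Nat.mod_eq_of_lt (by omega)]
    rw [hv]
    exact ⟨mem_univ _, hm.1, hm.2⟩
  · intro x _
    simp only [ZMod.natCast_zmod_val, add_sub_cancel]
  · intro m hm
    rw [mem_coe, mem_filter, mem_range] at hm
    simp only
    rw [add_sub_cancel_left, ZMod.val_natCast, Nat.mod_eq_of_lt (by omega)]

/-- **`S_t(A,B) = Σ_{b ∈ B} min(k, g_b)`, first half**: for `A = {0, …, k−1}`,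
`S_t(A,B) = Σ_{b ∈ B} w_b` with `w_b = #{m < k : c_b(m) + 1 ≤ t}` (the display "(3)" before
optimisation). [cite: NazarewiczEtAl2007, Lemma 1 (proof, eq. (3))] -/
theorem sum_min_rep_apFinset_eq {k : ℕ} (hk : k ≤ p) (B : Finset (ZMod p)) (t : ℕ) :
    ∑ x, min t (rep (apFinset (0 : ZMod p) 1 k) B x) =
      ∑ b ∈ B, #((range k).filter fun m =>
        #((Icc 1 m).filter fun i : ℕ => b + (i : ZMod p) ∈ B) + 1 ≤ t) := by
  rw [Fintype.sum_congr _ _ fun x => min_rep_eq_card_filter hk B t x]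
  exact sum_card_filter_val_sub hk B
    (fun b m => #((Icc 1 m).filter fun i : ℕ => b + (i : ZMod p) ∈ B) + 1 ≤ t)

/-- **`Σ_{b ∈ B} g_b = tp`** for `t ≤ |B|`, with `g_b = #{m < p : c_b(m) + 1 ≤ t}` (`= r_{j+t} − r_j`):
the same double count for the full window. [cite: NazarewiczEtAl2007, Lemma 1 (proof, "= tp −")] -/
theorem sum_card_filter_count_eq {B : Finset (ZMod p)} {t : ℕ} (ht : t ≤ #B) :
    ∑ b ∈ B, #((range p).filter fun m =>
        #((Icc 1 m).filter fun i : ℕ => b + (i : ZMod p) ∈ B) + 1 ≤ t) = t * p := by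
  rw [← sum_card_filter_val_sub le_rfl B
    (fun b m => #((Icc 1 m).filter fun i : ℕ => b + (i : ZMod p) ∈ B) + 1 ≤ t)]
  have hpt : ∀ x : ZMod p, #(B.filter fun b => (x - b).val < p ∧
      #((Icc 1 (x - b).val).filter fun i : ℕ => b + (i : ZMod p) ∈ B) + 1 ≤ t) = t := by
    intro x
    have h := min_rep_eq_card_filter le_rfl B t x
    rw [apFinset_eq_univ 0 one_ne_zero] at h
    rw [← h]
    have hrep : rep univ B x = #B := by
      rw [rep_eq_card_filter_right, filter_true_of_mem fun b _ => mem_univ _]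
    rw [hrep, min_eq_left ht]
  rw [Fintype.sum_congr _ _ hpt, sum_const, card_univ, ZMod.card, smul_eq_mul, mul_comm]

/-! ### The quantities `g_b` and `w_b = min(k, g_b)` -/

/-- `{m < K : c_b(m) + 1 ≤ t}` is an initial segment: it equals `{m < K : m < g_b}` with
`g_b = #{m < p : c_b(m) + 1 ≤ t}` (monotonicity of `c_b`), for `K ≤ p`; hence
`w_b = #{m < K : …} = min(K, g_b)`. [cite: NazarewiczEtAl2007, Lemma 1 (proof, "s_{j,t} = min{k, r_{j+t} − r_j}")] -/
theorem card_filter_count_eq_min (B : Finset (ZMod p)) (b : ZMod p) (t : ℕ) {K : ℕ} (hK : K ≤ p) :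
    #((range K).filter fun m => #((Icc 1 m).filter fun i : ℕ => b + (i : ZMod p) ∈ B) + 1 ≤ t) =
      min K #((range p).filter fun m =>
        #((Icc 1 m).filter fun i : ℕ => b + (i : ZMod p) ∈ B) + 1 ≤ t) := by
  set c : ℕ → ℕ := fun m => #((Icc 1 m).filter fun i : ℕ => b + (i : ZMod p) ∈ B) with hc
  set g := #((range p).filter fun m => c m + 1 ≤ t) with hg
  have hmono : ∀ m m', m ≤ m' → c m ≤ c m' := fun m m' h => count_mono B b h
  -- the `p`-window set is the initial segment `range g`
  have hseg : (range p).filter (fun m => c m + 1 ≤ t) = range g := by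
    -- an initial segment of `range p` (down-closed) equals `range` of its cardinality
    have hdown : ∀ m ∈ (range p).filter (fun m => c m + 1 ≤ t), ∀ m' ≤ m,
        m' ∈ (range p).filter (fun m => c m + 1 ≤ t) := by
      intro m hm m' hm'
      rw [mem_filter, mem_range] at hm ⊢
      exact ⟨by omega, (Nat.add_le_add_right (hmono m' m hm') 1).trans hm.2⟩
    apply eq_of_subset_of_card_le
    · intro m hm
      rw [mem_range]
      -- all of `0, …, m` lie in the set, so its card exceeds `m`
      have hsub : range (m + 1) ⊆ (range p).filter (fun m => c m + 1 ≤ t) := fun m' hm' =>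
        hdown m hm m' (by rw [mem_range] at hm'; omega)
      have := card_le_card hsub
      rw [card_range] at this
      rw [hg]; omega
    · rw [card_range]
  change #((range K).filter fun m => c m + 1 ≤ t) = min K g
  have hK' : (range K).filter (fun m => c m + 1 ≤ t) =
      ((range p).filter (fun m => c m + 1 ≤ t)).filter (fun m => m < K) := by
    ext m
    simp only [mem_filter, mem_range]
    constructor
    · rintro ⟨h1, h2⟩; exact ⟨⟨by omega, h2⟩, h1⟩
    · rintro ⟨⟨-, h2⟩, h1⟩; exact ⟨h1, h2⟩
  rw [hK', hseg]
  have : (range g).filter (fun m => m < K) = range (min K g) := by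
    ext m; simp only [mem_filter, mem_range, lt_min_iff]; tauto
  rw [this, card_range]

/-- `g_b ≥ t` (indeed `c_b(m) ≤ m`, so `m ≤ t − 1 ⇒ c_b(m) + 1 ≤ t`), for `t ≤ p`.
[cite: NazarewiczEtAl2007, Lemma 1 (proof)] -/
theorem le_card_filter_count (B : Finset (ZMod p)) (b : ZMod p) {t : ℕ} (htp : t ≤ p) :
    t ≤ #((range p).filter fun m => #((Icc 1 m).filter fun i : ℕ => b + (i : ZMod p) ∈ B) + 1 ≤ t) := by
  have hsub : range t ⊆ (range p).filter
      (fun m => #((Icc 1 m).filter fun i : ℕ => b + (i : ZMod p) ∈ B) + 1 ≤ t) := by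
    intro m hm
    rw [mem_range] at hm
    rw [mem_filter, mem_range]
    exact ⟨by omega, by have := count_le B b m; omega⟩
  have := card_le_card hsub
  rwa [card_range] at this

/-- `g_b ≤ p + t − |B|` ("`r_{j+t} − r_j ≤ p + t − ℓ`"). [cite: NazarewiczEtAl2007, Lemma 1 (proof)] -/
theorem card_filter_count_le (B : Finset (ZMod p)) (b : ZMod p) (t : ℕ) :
    #((range p).filter fun m => #((Icc 1 m).filter fun i : ℕ => b + (i : ZMod p) ∈ B) + 1 ≤ t) ≤
      p + t - #B := by
  have hsub : (range p).filter
      (fun m => #((Icc 1 m).filter fun i : ℕ => b + (i : ZMod p) ∈ B) + 1 ≤ t) ⊆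
      range (p + t - #B) := by
    intro m hm
    rw [mem_filter, mem_range] at hm
    rw [mem_range]
    have h1 := le_count_add B b hm.1
    have hBp : #B ≤ p := (card_le_univ B).trans (ZMod.card p).le
    omega
  have := card_le_card hsub
  rwa [card_range] at this

/-- `g_b = t` forces `b + 1, …, b + t ∈ B` ("`r_{j+t} − r_j = t` … implies that for each `j ∈ J_1` we
have `r_j + i + pℤ ∈ B` for each `i ∈ {0, …, t}`"), for `t < p`.
[cite: NazarewiczEtAl2007, Lemma 1 (proof)] -/
theorem forall_add_mem_of_card_filter_count_eq (B : Finset (ZMod p)) (b : ZMod p) {t : ℕ} (htp : t < p)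
    (h : #((range p).filter fun m =>
      #((Icc 1 m).filter fun i : ℕ => b + (i : ZMod p) ∈ B) + 1 ≤ t) ≤ t) :
    ∀ i : ℕ, 1 ≤ i → i ≤ t → b + (i : ZMod p) ∈ B := by
  apply forall_add_mem_of_le_count
  by_contra hlt
  push Not at hlt
  -- then `t` itself lies in the set, together with `0, …, t-1`: `t + 1` elements
  have hsub : range (t + 1) ⊆ (range p).filter
      (fun m => #((Icc 1 m).filter fun i : ℕ => b + (i : ZMod p) ∈ B) + 1 ≤ t) := by
    intro m hm
    rw [mem_range] at hm
    rw [mem_filter, mem_range]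
    refine ⟨by omega, ?_⟩
    have := count_mono B b (show m ≤ t by omega)
    omega
  have := card_le_card hsub
  rw [card_range] at this
  omega

/-! ### Lemma 1 for `A = {0, …, k−1}` -/

/-- **Lemma 1, normalised** (`A = {0, 1, …, k−1}`): if `1 < t < min(k, |B|)`, `k + |B| < p + t` and
`(A, B)` is `t`-critical, then `B` is an arithmetic progression with difference `1`.
[cite: NazarewiczEtAl2007, Lemma 1] -/
theorem isAP_one_of_critical {B : Finset (ZMod p)} {k t : ℕ} (ht : 1 < t) (htk : t < k) (htB : t < #B)
    (hkB : k + #B < p + t)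
    (hcrit : ∑ x, min t (rep (apFinset (0 : ZMod p) 1 k) B x) = t * (k + #B - t)) :
    IsAP B 1 := by
  have hprime := hp.out
  have hp2 := hprime.two_le
  have hkp : k ≤ p := by omega
  have hBp : #B + 2 ≤ p := by omega
  set ℓ := #B with hℓ
  -- notation: `g b` and `w b = min(k, g b)`
  set g : ZMod p → ℕ := fun b => #((range p).filter fun m =>
    #((Icc 1 m).filter fun i : ℕ => b + (i : ZMod p) ∈ B) + 1 ≤ t) with hg
  have hS : t * (k + ℓ - t) = ∑ b ∈ B, min k (g b) := by
    rw [← hcrit, sum_min_rep_apFinset_eq hkp B t]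
    exact sum_congr rfl fun b _ => card_filter_count_eq_min B b t hkp
  have hG : ∑ b ∈ B, g b = t * p := sum_card_filter_count_eq htB.le
  have hg_ge : ∀ b, t ≤ g b := fun b => le_card_filter_count B b (by omega)
  have hg_le : ∀ b, g b ≤ p + t - ℓ := fun b => card_filter_count_le B b t
  -- `J0 = {b ∈ B : g b > k}` has at most `t` elements
  obtain ⟨J0, hJ0⟩ : ∃ J0 : Finset (ZMod p), J0 = B.filter fun b => k < g b := ⟨_, rfl⟩
  obtain ⟨J1, hJ1⟩ : ∃ J1 : Finset (ZMod p), J1 = B.filter fun b => ¬ k < g b := ⟨_, rfl⟩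
  have hJcard : #J0 + #J1 = ℓ := by
    rw [hJ0, hJ1]; exact card_filter_add_card_filter_not _
  have hsplit : ∀ f : ZMod p → ℕ, ∑ b ∈ B, f b = ∑ b ∈ J0, f b + ∑ b ∈ J1, f b := by
    intro f; rw [hJ0, hJ1]; exact (sum_filter_add_sum_filter_not B _ f).symm
  -- on `J0`, `min k (g b) = k`; on `J1`, `min k (g b) = g b ≥ t`
  have hS0 : ∑ b ∈ J0, min k (g b) = k * #J0 := by
    rw [sum_const_nat (m := k) fun b hb => ?_, mul_comm]
    rw [hJ0, mem_filter] at hb; exact min_eq_left hb.2.le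
  have hS1 : ∑ b ∈ J1, min k (g b) = ∑ b ∈ J1, g b :=
    sum_congr rfl fun b hb => by rw [hJ1, mem_filter] at hb; exact min_eq_right (not_lt.1 hb.2)
  have hS1ge : t * #J1 ≤ ∑ b ∈ J1, g b := by
    rw [mul_comm]
    calc #J1 * t = ∑ _b ∈ J1, t := by rw [sum_const, smul_eq_mul]
      _ ≤ ∑ b ∈ J1, g b := sum_le_sum fun b _ => hg_ge b
  have hG0le : ∑ b ∈ J0, g b ≤ (p + t - ℓ) * #J0 := by
    rw [mul_comm]
    calc ∑ b ∈ J0, g b ≤ ∑ _b ∈ J0, (p + t - ℓ) := sum_le_sum fun b _ => hg_le b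
      _ = #J0 * (p + t - ℓ) := by rw [sum_const, smul_eq_mul]
  rw [hsplit, hS0, hS1] at hS
  rw [hsplit] at hG
  -- `|J0| ≤ t`: from `t(k+ℓ-t) = k|J0| + Σ_{J1} g ≥ k|J0| + t|J1| = tℓ + (k - t)|J0|`
  have hJ0le : #J0 ≤ t := by
    by_contra hlt
    push Not at hlt
    have h1 : k * #J0 + t * #J1 ≤ t * (k + ℓ - t) := by rw [hS]; exact Nat.add_le_add_left hS1ge _
    have hsub : t ≤ k + ℓ := by omega
    zify [hsub] at h1
    have hJc : (#J1 : ℤ) = ℓ - #J0 := by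
      have := hJcard; zify at this; linarith
    rw [hJc] at h1
    have hkt : (1 : ℤ) ≤ (k : ℤ) - t := by
      have := htk; zify at this; linarith
    have hat : (1 : ℤ) ≤ (#J0 : ℤ) - t := by
      have := hlt; zify at this; linarith
    nlinarith [mul_le_mul hkt hat (by norm_num) (by linarith)]
  -- `|J0| ≥ t`: from `tp = Σ_{J0} g + Σ_{J1} g ≤ (p+t-ℓ)|J0| + t(k+ℓ-t) - k|J0|`, i.e.
  -- `t(p + t - k - ℓ) ≤ (p + t - k - ℓ)|J0|`
  have hJ0ge : t ≤ #J0 := by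
    by_contra hlt
    push Not at hlt
    have h1 : t * p ≤ (p + t - ℓ) * #J0 + ∑ b ∈ J1, g b := by
      rw [← hG]; exact Nat.add_le_add_right hG0le _
    have h2 : ∑ b ∈ J1, g b + k * #J0 = t * (k + ℓ - t) := by rw [hS]; ring
    have h3 : t * p + k * #J0 ≤ (p + t - ℓ) * #J0 + t * (k + ℓ - t) := by
      calc t * p + k * #J0 ≤ (p + t - ℓ) * #J0 + ∑ b ∈ J1, g b + k * #J0 := by omega
        _ = (p + t - ℓ) * #J0 + t * (k + ℓ - t) := by rw [add_assoc, h2]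
    have hsub1 : t ≤ k + ℓ := by omega
    have hsub2 : ℓ ≤ p + t := by omega
    zify [hsub1, hsub2] at h3
    have hD1 : (1 : ℤ) ≤ (p : ℤ) + t - ℓ - k := by
      have := hkB; zify at this; linarith
    have hat : (#J0 : ℤ) ≤ t - 1 := by
      have := hlt; zify at this; linarith
    nlinarith [mul_le_mul_of_nonneg_left hat (by linarith : (0 : ℤ) ≤ (p : ℤ) + t - ℓ - k)]
  have hJ0eq : #J0 = t := le_antisymm hJ0le hJ0ge
  -- now `Σ_{J1} g = t(k+ℓ-t) - k t = t(ℓ - t) = t |J1|`, so `g = t` on `J1`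
  have hJ1card : #J1 = ℓ - t := by omega
  have hsumJ1 : ∑ b ∈ J1, g b = t * #J1 := by
    have h2 : ∑ b ∈ J1, g b + k * #J0 = t * (k + ℓ - t) := by rw [hS]; ring
    rw [hJ0eq] at h2
    rw [hJ1card]
    have : t * (k + ℓ - t) = t * (ℓ - t) + k * t := by
      have : k + ℓ - t = (ℓ - t) + k := by omega
      rw [this, mul_add, mul_comm t k]
    omega
  have hgJ1 : ∀ b ∈ J1, g b = t := by
    -- all terms are `≥ t` and the sum is `t |J1|`
    have hle : ∀ b ∈ J1, t ≤ g b := fun b _ => hg_ge b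
    by_contra hne
    push Not at hne
    obtain ⟨b₀, hb₀, hne⟩ := hne
    have hlt : t < g b₀ := lt_of_le_of_ne (hle b₀ hb₀) (Ne.symm hne)
    have := sum_lt_sum hle ⟨b₀, hb₀, hlt⟩
    rw [sum_const, smul_eq_mul, hsumJ1, mul_comm] at this
    exact lt_irrefl _ this
  -- the full elements
  have hfull : ∀ b ∈ J1, ∀ i : ℕ, 1 ≤ i → i ≤ t → b + (i : ZMod p) ∈ B := fun b hb =>
    forall_add_mem_of_card_filter_count_eq B b (by omega) (hgJ1 b hb).le
  have hJ1B : J1 ⊆ B := by rw [hJ1]; exact filter_subset _ _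
  have hJ1ne : J1.Nonempty := card_pos.1 (by omega)
  -- `T = {b ∈ B : b + 1 ∈ B} ⊇ J1 + {0, …, t-1}`
  obtain ⟨T, hT⟩ : ∃ T : Finset (ZMod p), T = B.filter fun b => b + 1 ∈ B := ⟨_, rfl⟩
  have hTsup : J1 + apFinset (0 : ZMod p) 1 t ⊆ T := by
    intro x hx
    obtain ⟨b, hb, y, hy, rfl⟩ := mem_add.1 hx
    obtain ⟨i, hi, rfl⟩ := mem_apFinset.1 hy
    rw [hT, mem_filter, zero_add, nsmul_eq_mul, mul_one]
    constructor
    · rcases Nat.eq_zero_or_pos i with h0 | hpos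
      · subst h0; simpa using hJ1B hb
      · exact hfull b hb i hpos (by omega)
    · have := hfull b hb (i + 1) (by omega) (by omega)
      push_cast at this
      rw [add_assoc]; exact this
  have hTcard : ℓ ≤ #T + 1 := by
    have hcd := ZMod.cauchy_davenport hprime hJ1ne (apFinset_nonempty (0 : ZMod p) 1 (by omega : 0 < t))
    rw [card_apFinset one_ne_zero (by omega : t ≤ p), hJ1card,
      min_eq_right (by omega : ℓ - t + t - 1 ≤ p)] at hcd
    have := card_le_card hTsup
    omega
  -- `T ≠ B`
  have hBne : B.Nonempty := card_pos.1 (by omega)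
  have hTne : T ≠ B := by
    intro hTB
    have hall : ∀ b ∈ B, b + 1 ∈ B := by
      intro b hb
      have : b ∈ T := hTB ▸ hb
      rw [hT, mem_filter] at this
      exact this.2
    have := Pollard.eq_univ_of_add_mem hBne one_ne_zero hall
    rw [this, card_univ, ZMod.card] at hℓ
    omega
  have hTB : T ⊆ B := by rw [hT]; exact filter_subset _ _
  have hTcardB : #T + 1 = ℓ := by
    have h1 : #T < ℓ :=
      lt_of_le_of_ne (card_le_card hTB) fun h => hTne (eq_of_subset_of_card_le hTB h.ge)
    omega
  -- `|B ∪ (1 + B)| = |B| + #{b ∈ B : b + 1 ∉ B} = |B| + 1`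
  have hunion : #(B ∪ ((1 : ZMod p) +ᵥ B)) = #B + 1 := by
    have h1 : #(B ∪ ((1 : ZMod p) +ᵥ B)) = #B + #(((1 : ZMod p) +ᵥ B) \ B) := by
      rw [← card_union_of_disjoint disjoint_sdiff, union_sdiff_self_eq_union]
    have h2 : #(((1 : ZMod p) +ᵥ B) \ B) = #(B.filter fun b => ¬ b + 1 ∈ B) := by
      symm
      refine card_nbij' (fun b => b + 1) (fun x => x - 1) ?_ ?_ ?_ ?_
      · intro b hb
        simp only [mem_coe, mem_filter, mem_sdiff] at hb ⊢
        exact ⟨mem_vadd_finset.2 ⟨b, hb.1, by rw [vadd_eq_add, add_comm]⟩, hb.2⟩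
      · intro x hx
        simp only [mem_coe, mem_sdiff, mem_filter] at hx ⊢
        obtain ⟨hx1, hxB⟩ := hx
        obtain ⟨b, hb, hbx⟩ := mem_vadd_finset.1 hx1
        rw [vadd_eq_add] at hbx
        have hxb : x - 1 = b := by rw [← hbx]; ring
        refine ⟨by rw [hxb]; exact hb, ?_⟩
        rw [sub_add_cancel]; exact hxB
      · intro b _; simp
      · intro x _; simp
    have h3 := card_filter_add_card_filter_not (s := B) (fun b => b + 1 ∈ B)
    rw [← hT] at h3
    rw [h1, h2]
    omega
  exact Vosper.isAP_of_card_union_vadd hBne one_ne_zero hunion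

/-! ### Dilations, and Lemma 1 in general position -/

/-- Dilating a progression: `c · {a + i d} = {ca + i (cd)}`. [cite: NazarewiczEtAl2007, Lemma 1 (proof, "Dividing by d")] -/
theorem image_mul_apFinset (c a d : ZMod p) (n : ℕ) :
    (apFinset a d n).image (c * ·) = apFinset (c * a) (c * d) n := by
  ext x
  simp only [mem_image, mem_apFinset]
  constructor
  · rintro ⟨y, ⟨i, hi, rfl⟩, rfl⟩
    exact ⟨i, hi, by rw [nsmul_eq_mul, nsmul_eq_mul]; ring⟩
  · rintro ⟨i, hi, rfl⟩
    exact ⟨a + i • d, ⟨i, hi, rfl⟩, by rw [nsmul_eq_mul, nsmul_eq_mul]; ring⟩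

/-- A dilate of a progression is a progression. [cite: NazarewiczEtAl2007, Lemma 1 (proof)] -/
theorem IsAP.image_mul {s : Finset (ZMod p)} {d : ZMod p} (h : IsAP s d) {c : ZMod p} (hc : c ≠ 0) :
    IsAP (s.image (c * ·)) (c * d) := by
  obtain ⟨a, hs⟩ := h
  refine ⟨c * a, ?_⟩
  rw [card_image_of_injective _ (mul_right_injective₀ hc)]
  conv_lhs => rw [hs]
  exact image_mul_apFinset c a d _

/-- The representation function is invariant under dilation by a unit:
`r_{cA, cB}(cx) = r_{A,B}(x)`. [cite: NazarewiczEtAl2007, Lemma 1 (proof, "Dividing by d")] -/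
theorem rep_image_mul {c : ZMod p} (hc : c ≠ 0) (A B : Finset (ZMod p)) (x : ZMod p) :
    rep (A.image (c * ·)) (B.image (c * ·)) (c * x) = rep A B x := by
  rw [rep_eq_card_filter_right, rep_eq_card_filter_right, filter_image,
    card_image_of_injective _ (mul_right_injective₀ hc)]
  congr 1
  refine filter_congr fun b _ => ?_
  simp only [mem_image]
  constructor
  · rintro ⟨a, ha, hax⟩
    have : a = x - b := mul_right_injective₀ hc (by simp only; rw [hax]; ring)
    rwa [← this]
  · intro h
    exact ⟨x - b, h, by ring⟩

/-- `S_t` is invariant under dilation by a unit. [cite: NazarewiczEtAl2007, Lemma 1 (proof)] -/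
theorem sum_min_rep_image_mul {c : ZMod p} (hc : c ≠ 0) (A B : Finset (ZMod p)) (t : ℕ) :
    ∑ x, min t (rep (A.image (c * ·)) (B.image (c * ·)) x) = ∑ x, min t (rep A B x) := by
  have hbij : Function.Bijective fun x : ZMod p => c * x :=
    (Finite.injective_iff_bijective).1 (mul_right_injective₀ hc)
  rw [← (Equiv.ofBijective _ hbij).sum_comp]
  refine Fintype.sum_congr _ _ fun x => ?_
  rw [Equiv.ofBijective_apply, rep_image_mul hc]

/-- **Lemma 1.** Let `(A, B)` be a `t`-critical pair in `ℤ/pℤ` (`S_t(A,B) = t(|A| + |B| − t)`) with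
`1 < t < min(|A|, |B|)` and `|A| + |B| < p + t`.  If `A` is an arithmetic progression with difference
`d ≠ 0`, then `B` is an arithmetic progression with the same difference `d`.
[cite: NazarewiczEtAl2007, Lemma 1] -/
theorem isAP_of_critical_of_isAP {A B : Finset (ZMod p)} {d : ZMod p} {t : ℕ} (hd : d ≠ 0)
    (hA : IsAP A d) (ht : 1 < t) (htA : t < #A) (htB : t < #B) (hAB : #A + #B < p + t)
    (hcrit : ∑ x, min t (rep A B x) = t * (#A + #B - t)) : IsAP B d := by
  obtain ⟨a, hAeq⟩ := hA
  set k := #A with hk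
  set c := d⁻¹ with hc
  have hcd : c * d = 1 := inv_mul_cancel₀ hd
  have hc0 : c ≠ 0 := by intro h; rw [h, zero_mul] at hcd; exact zero_ne_one hcd
  -- dilate by `c` and translate `A` to `{0, …, k-1}`
  set B₁ := (B.image (c * ·)).image (· + (0 : ZMod p)) with hB₁
  have hB₁card : #B₁ = #B := by
    rw [hB₁, card_image_of_injective _ (add_left_injective _),
      card_image_of_injective _ (mul_right_injective₀ hc0)]
  have hA₁ : (A.image (c * ·)).image (· + -(c * a)) = apFinset (0 : ZMod p) 1 k := by
    rw [hAeq, image_mul_apFinset, hcd, ← vadd_finset_eq_image, vadd_apFinset, neg_add_cancel]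
  have hcrit₁ : ∑ x, min t (rep (apFinset (0 : ZMod p) 1 k) B₁ x) = t * (k + #B₁ - t) := by
    rw [← hA₁, hB₁, sum_min_rep_image_add, sum_min_rep_image_mul hc0, hcrit, hB₁card]
  have hB₁AP : IsAP B₁ 1 :=
    isAP_one_of_critical ht htA (by rw [hB₁card]; exact htB) (by rw [hB₁card]; exact hAB) hcrit₁
  -- undo: `B₁ = c · B`, so `B = d · B₁`
  have hB₁' : B₁ = B.image (c * ·) := by
    rw [hB₁]; conv_rhs => rw [← image_id (s := B.image (c * ·))]
    exact image_congr fun x _ => by simp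
  have hB : B = B₁.image (d * ·) := by
    rw [hB₁', image_image]
    have : ((d * ·) ∘ (c * ·) : ZMod p → ZMod p) = id := by
      ext x; simp only [Function.comp, id]; rw [← mul_assoc, mul_comm d c, hcd, one_mul]
    rw [this, image_id]
  rw [hB]
  have := IsAP.image_mul hB₁AP hd
  rwa [mul_one] at this

/-- **Lemma 1, symmetric form**: if `B` is a progression with difference `d ≠ 0` then so is `A`.
[cite: NazarewiczEtAl2007, Lemma 1] -/
theorem isAP_of_critical_of_isAP_right {A B : Finset (ZMod p)} {d : ZMod p} {t : ℕ} (hd : d ≠ 0)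
    (hB : IsAP B d) (ht : 1 < t) (htA : t < #A) (htB : t < #B) (hAB : #A + #B < p + t)
    (hcrit : ∑ x, min t (rep A B x) = t * (#A + #B - t)) : IsAP A d := by
  refine isAP_of_critical_of_isAP hd hB ht htB htA (by omega) ?_
  rw [add_comm #B, ← hcrit]
  exact Fintype.sum_congr _ _ fun x => by rw [rep_comm]

end ZModP

end PollardEquality

end Literature.Combinatorics.Additive
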